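import Summits.ValiantsHypothesis.ValiantsHypothesis.Theses.UlrichPadded
import Summits.ValiantsHypothesis.ValiantsHypothesis.Theorems.UlrichPaddedRankOneTrivialisation

/-!
# `UlrichPadded.CofactorDegreeFloor` (stmt-ValiantsHypothesis-5669): some cofactor of an affine
determinantal representation of `per_n` (`n ≥ 3`) has a homogeneous component of degree
`≥ 2n − 2` outside `(per_n)`

Support item (rank 9) of route `UlrichPadded`:

  `∀ n ≥ 3, ∀ m (A : Matrix (Fin m) (Fin m) ℂ[x_{n×n}]), IsAffineDetRepr per_n A →
     ∃ i j d, 2n − 2 ≤ d ∧ (adj A i j)_d ∉ (per_n)`.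

Since `(per_n)` is a homogeneous ideal this says: `adj A` is not congruent modulo `per_n` to a
polynomial matrix of entrywise degree `≤ 2n − 3` (the budget inequality `j ≤ m + 1 − 2n` of the
route in cofactor form).

## Proof (the route review's paper argument, refuter c894e0d7; no Gröbner bases needed)

Write `p = per_n`, `I = (p)` — a homogeneous prime (`perPoly_irreducible`, `perPoly_isHomogeneous`).

1. **Rank one** (closed crux 5667, `rankOneTrivialisation_of_parts`): `adj A ≡ c wᵀ (mod p)`.
   Replace every `cᵢ`, `wⱼ` by a representative `qᵢ`, `rⱼ` of minimal total degree of its class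
   (`RankOneTrivialisation.exists_minimal_rep`); still `adj A ≡ q rᵀ (mod p)`.
2. **`adj A ≢ 0 (mod p)`** (`exists_adjugate_notMem_span`): otherwise `adj A = p C`, and
   `adj A · A = det A · 1 = p · 1` gives `C A = 1`, so `p = det A` is a unit — but `p` is prime.
   Hence some `q_{i₁} ∉ I` and some `r_{j₁} ∉ I`.
3. **Kernel-degree floor** (`eq_zero_of_mulVec_mem_span`): `A · adj A = p · 1 ≡ 0`, so
   `(A q)ᵢ · r_{j₁} ∈ I` and, `I` being prime, `A q ≡ 0 (mod p)`.  If all `deg qᵢ ≤ dc` with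
   `dc + 1 < n = deg p`, every entry of `A q` has degree `< deg p` and lies in `(p)`, hence vanishes
   (`totalDegree_le_of_dvd_of_isDomain`); `det A = p ≠ 0` then forces `q = 0`
   (`Matrix.exists_mulVec_eq_zero_iff`), contradicting `q_{i₁} ∉ I`.  So `dc := max deg qᵢ ≥ n − 1`,
   and symmetrically (`adj A · A = p · 1`, `Matrix.exists_vecMul_eq_zero_iff`) `dw := max deg rⱼ ≥ n − 1`.
4. **Top components** : pick `i₀`, `j₀` attaining `dc`, `dw`.  A non-zero minimal representative
   has its top component outside `(p)` (`RankOneTrivialisation.top_notMem_of_minimal`), so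
   `(q_{i₀})_dc, (r_{j₀})_dw ∉ I` and, `I` prime, `(q_{i₀})_dc (r_{j₀})_dw ∉ I`.  But this product is
   the degree-`(dc + dw)` component of `q_{i₀} r_{j₀}` (`homogeneousComponent_mul_of_totalDegree_le`),
   which is congruent modulo the homogeneous ideal `I` to the degree-`(dc + dw)` component of
   `adj A i₀ j₀` (`RankOneTrivialisation.homogeneousComponent_mem_span`).  Hence
   `(adj A i₀ j₀)_{dc+dw} ∉ I` with `dc + dw ≥ 2n − 2`.

## References

* [Vonzurgathen1987] J. von zur Gathen, *Permanent and determinant*, LAA 96 (1987), Thm. 3.4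
  (irreducibility of `per_n`).
* [KernerVinnikov2012], [Grenet2011] (the route's sources for this item: kernel sheaves; Grenet's
  `7 × 7` representation of `per_3` realises the floor with `d = 4 = 2n − 2`).
-/

noncomputable section

namespace Summit.ValiantsHypothesis.Theorems

open MvPolynomial Matrix Literature.Computability.AlgebraicComplexity
open Summit.ValiantsHypothesis.Theorems.RankOneTrivialisation

namespace CofactorDegreeFloor

variable {K : Type*} [Field K] {σ : Type*}

/-- An element of the principal ideal `(f)` of total degree `< deg f` is zero (degrees add over a
domain). [folklore] -/
theorem eq_zero_of_mem_span_of_totalDegree_lt {f g : MvPolynomial σ K}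
    (hg : g ∈ Ideal.span {f}) (hlt : g.totalDegree < f.totalDegree) : g = 0 := by
  by_contra hg0
  exact absurd (totalDegree_le_of_dvd_of_isDomain (Ideal.mem_span_singleton.1 hg) hg0) (not_le.2 hlt)

/-- **Kernel-degree floor, column form.** If `A` is a square matrix of affine linear forms with
`det A ≠ 0` and `c` a polynomial vector with `deg cᵢ ≤ dc`, `dc + 1 < deg f` and `A c ≡ 0 (mod f)`
entrywise, then `c = 0`: every entry of `A c` has degree `< deg f` inside `(f)`, so `A c = 0`
exactly, and `A` has trivial kernel over the polynomial domain. [folklore] -/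
theorem eq_zero_of_mulVec_mem_span {m : ℕ} {A : Matrix (Fin m) (Fin m) (MvPolynomial σ K)}
    (hA : ∀ i j, (A i j).totalDegree ≤ 1) (hdet : A.det ≠ 0) {f : MvPolynomial σ K}
    {c : Fin m → MvPolynomial σ K} {dc : ℕ} (hc : ∀ i, (c i).totalDegree ≤ dc)
    (hlt : dc + 1 < f.totalDegree) (hker : ∀ i, (A *ᵥ c) i ∈ Ideal.span {f}) : c = 0 := by
  have hzero : A *ᵥ c = 0 := by
    funext i
    refine eq_zero_of_mem_span_of_totalDegree_lt (hker i) (lt_of_le_of_lt ?_ hlt)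
    rw [Matrix.mulVec_apply_eq_sum]
    refine totalDegree_finsetSum_le fun j _ => (totalDegree_mul _ _).trans ?_
    exact (add_le_add (hA i j) (hc j)).trans_eq (add_comm _ _)
  by_contra hc0
  exact hdet (Matrix.exists_mulVec_eq_zero_iff.1 ⟨c, hc0, hzero⟩)

/-- **Kernel-degree floor, row form.** If `A` is a square matrix of affine linear forms with
`det A ≠ 0` and `w` a polynomial vector with `deg wⱼ ≤ dw`, `dw + 1 < deg f` and `wᵀ A ≡ 0 (mod f)`
entrywise, then `w = 0`. [folklore] -/
theorem eq_zero_of_vecMul_mem_span {m : ℕ} {A : Matrix (Fin m) (Fin m) (MvPolynomial σ K)}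
    (hA : ∀ i j, (A i j).totalDegree ≤ 1) (hdet : A.det ≠ 0) {f : MvPolynomial σ K}
    {w : Fin m → MvPolynomial σ K} {dw : ℕ} (hw : ∀ j, (w j).totalDegree ≤ dw)
    (hlt : dw + 1 < f.totalDegree) (hker : ∀ j, (w ᵥ* A) j ∈ Ideal.span {f}) : w = 0 := by
  have hzero : w ᵥ* A = 0 := by
    funext j
    refine eq_zero_of_mem_span_of_totalDegree_lt (hker j) (lt_of_le_of_lt ?_ hlt)
    rw [Matrix.vecMul_apply_eq_sum]
    refine totalDegree_finsetSum_le fun i _ => (totalDegree_mul _ _).trans ?_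
    exact add_le_add (hw i) (hA i j)
  by_contra hw0
  exact hdet (Matrix.exists_vecMul_eq_zero_iff.1 ⟨w, hw0, hzero⟩)

/-- **The adjugate of a matrix with prime determinant is non-zero modulo that determinant.**  If
every cofactor of `A` were a multiple of the prime `p = det A`, then `adj A = p C` and
`adj A · A = p · 1` would give `C A = 1`, making `p` a unit. [folklore] -/
theorem exists_adjugate_notMem_span {m : ℕ} {A : Matrix (Fin m) (Fin m) (MvPolynomial σ K)}
    {p : MvPolynomial σ K} (hp : Prime p) (hdet : A.det = p) :
    ∃ i j, A.adjugate i j ∉ Ideal.span {p} := by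
  by_contra hall
  have hall' : ∀ i j, A.adjugate i j ∈ Ideal.span {p} := fun i j =>
    not_not.mp fun h => hall ⟨i, j, h⟩
  choose C hC using fun i j => Ideal.mem_span_singleton'.1 (hall' i j)
  have hpC : p • (Matrix.of fun i j => C i j) = A.adjugate := by
    refine Matrix.ext fun i j => ?_
    simp only [Matrix.smul_apply, Matrix.of_apply, smul_eq_mul]
    rw [mul_comm]
    exact hC i j
  have h1 : p • ((Matrix.of fun i j => C i j) * A) = p • (1 : Matrix (Fin m) (Fin m) _) := by
    rw [← Matrix.smul_mul, hpC, Matrix.adjugate_mul, hdet]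
  have hCA : (Matrix.of fun i j => C i j) * A = 1 := by
    refine Matrix.ext fun i j => ?_
    have := congr_fun (congr_fun h1 i) j
    simp only [Matrix.smul_apply, smul_eq_mul] at this
    exact mul_left_cancel₀ hp.ne_zero this
  have h := congr_arg Matrix.det hCA
  rw [Matrix.det_mul, Matrix.det_one, hdet] at h
  exact hp.not_unit (isUnit_iff_exists_inv'.mpr ⟨_, h⟩)

end CofactorDegreeFloor

open CofactorDegreeFloor

/-- **`CofactorDegreeFloor`, unfolded.** For `n ≥ 3` and every affine determinantal representation
`A` of `per_n` of size `m` over `ℂ`, some cofactor `adj A i j` has a homogeneous component of degree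
`d ≥ 2n − 2` outside `(per_n)`.  Proof: rank-one trivialisation `adj A ≡ q rᵀ` with minimal
representatives (closed crux 5667 and its degree engine), `adj A ≢ 0`, the kernel-degree floors
`max deg qᵢ, max deg rⱼ ≥ n − 1`, and top components of minimal representatives multiply outside the
homogeneous prime `(per_n)`. [folklore] -/
theorem cofactorDegreeFloor_of_rankOne (n : ℕ) (hn : 3 ≤ n) (m : ℕ)
    (A : Matrix (Fin m) (Fin m) (MvPolynomial (Fin n × Fin n) ℂ))
    (hA : IsAffineDetRepr (perPoly (Fin n) ℂ) A) :
    ∃ (i j : Fin m) (d : ℕ), 2 * n - 2 ≤ d ∧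
      MvPolynomial.homogeneousComponent d (A.adjugate i j) ∉ Ideal.span {perPoly (Fin n) ℂ} := by
  classical
  set p := perPoly (Fin n) ℂ with hp_def
  set I : Ideal (MvPolynomial (Fin n × Fin n) ℂ) := Ideal.span {p} with hI
  haveI : Nonempty (Fin n) := ⟨⟨0, by omega⟩⟩
  have hprime : Prime p := (perPoly_irreducible (n := Fin n) (R := ℂ)).prime
  have hIprime : I.IsPrime := (Ideal.span_singleton_prime hprime.ne_zero).mpr hprime
  have hp0 : p ≠ 0 := perPoly_ne_zero (Fin n) ℂ
  have hhom : p.IsHomogeneous n := by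
    have h := perPoly_isHomogeneous (n := Fin n) (k := ℂ)
    rwa [Fintype.card_fin] at h
  have hpdeg : p.totalDegree = n := hhom.totalDegree hp0
  have hdetA : A.det = p := hA.2
  have hdet0 : A.det ≠ 0 := hdetA ▸ hp0
  -- 1. rank-one trivialisation (closed crux 5667) and minimal representatives
  obtain ⟨c, w, _, _, -, -, -, hcw⟩ := rankOneTrivialisation_of_parts n hn m A hA
  choose q hq using fun i => exists_minimal_rep I (c i)
  choose r hr using fun j => exists_minimal_rep I (w j)
  have hBqr : ∀ i j, A.adjugate i j - q i * r j ∈ I := by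
    intro i j
    have h1 : c i * w j - q i * r j ∈ I := by
      have := I.add_mem (I.mul_mem_right (w j) (hq i).1) (I.mul_mem_left (q i) (hr j).1)
      convert this using 1
      ring
    have := I.add_mem (hcw i j) h1
    rwa [sub_add_sub_cancel] at this
  -- 2. `adj A ≢ 0 (mod p)`, hence `q ≢ 0` and `r ≢ 0`
  obtain ⟨i₁, j₁, hij⟩ := exists_adjugate_notMem_span hprime hdetA
  have hq₁ : q i₁ ∉ I := by
    intro hmem
    apply hij
    have := I.add_mem (hBqr i₁ j₁) (I.mul_mem_right (r j₁) hmem)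
    rwa [sub_add_cancel] at this
  have hr₁ : r j₁ ∉ I := by
    intro hmem
    apply hij
    have := I.add_mem (hBqr i₁ j₁) (I.mul_mem_left (q i₁) hmem)
    rwa [sub_add_cancel] at this
  have hq0 : q ≠ 0 := fun h => hq₁ (by rw [h, Pi.zero_apply]; exact I.zero_mem)
  have hr0 : r ≠ 0 := fun h => hr₁ (by rw [h, Pi.zero_apply]; exact I.zero_mem)
  -- degrees of the minimal representatives
  set dc := Finset.univ.sup fun i => (q i).totalDegree with hdc_def
  set dw := Finset.univ.sup fun j => (r j).totalDegree with hdw_def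
  have hqdeg : ∀ i, (q i).totalDegree ≤ dc := fun i =>
    Finset.le_sup (f := fun i => (q i).totalDegree) (Finset.mem_univ i)
  have hrdeg : ∀ j, (r j).totalDegree ≤ dw := fun j =>
    Finset.le_sup (f := fun j => (r j).totalDegree) (Finset.mem_univ j)
  -- 3. kernel-degree floors: `A q ≡ 0`, `rᵀ A ≡ 0 (mod p)` force `dc, dw ≥ n − 1`
  have hAq : ∀ i, (A *ᵥ q) i ∈ I := by
    intro i
    have h1 : (A * A.adjugate) i j₁ ∈ I := by
      rw [Matrix.mul_adjugate, hdetA, Matrix.smul_apply, smul_eq_mul]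
      exact I.mul_mem_right _ (Ideal.subset_span rfl)
    have h2 : (A * A.adjugate) i j₁ - (A *ᵥ q) i * r j₁ ∈ I := by
      rw [Matrix.mul_apply, Matrix.mulVec_apply_eq_sum, Finset.sum_mul, ← Finset.sum_sub_distrib]
      refine I.sum_mem fun k _ => ?_
      have : A i k * A.adjugate k j₁ - A i k * q k * r j₁ =
          A i k * (A.adjugate k j₁ - q k * r j₁) := by ring
      rw [this]
      exact I.mul_mem_left _ (hBqr k j₁)
    have h3 : (A *ᵥ q) i * r j₁ ∈ I := by
      have := I.sub_mem h1 h2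
      rwa [sub_sub_cancel] at this
    exact (hIprime.mem_or_mem h3).resolve_right hr₁
  have hrA : ∀ j, (r ᵥ* A) j ∈ I := by
    intro j
    have h1 : (A.adjugate * A) i₁ j ∈ I := by
      rw [Matrix.adjugate_mul, hdetA, Matrix.smul_apply, smul_eq_mul]
      exact I.mul_mem_right _ (Ideal.subset_span rfl)
    have h2 : (A.adjugate * A) i₁ j - q i₁ * (r ᵥ* A) j ∈ I := by
      rw [Matrix.mul_apply, Matrix.vecMul_apply_eq_sum, Finset.mul_sum, ← Finset.sum_sub_distrib]
      refine I.sum_mem fun k _ => ?_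
      have : A.adjugate i₁ k * A k j - q i₁ * (r k * A k j) =
          (A.adjugate i₁ k - q i₁ * r k) * A k j := by ring
      rw [this]
      exact I.mul_mem_right _ (hBqr i₁ k)
    have h3 : q i₁ * (r ᵥ* A) j ∈ I := by
      have := I.sub_mem h1 h2
      rwa [sub_sub_cancel] at this
    exact (hIprime.mem_or_mem h3).resolve_left hq₁
  have hdc : n ≤ dc + 1 := by
    by_contra hlt
    exact hq0 (eq_zero_of_mulVec_mem_span hA.1 hdet0 hqdeg
      (by rw [hpdeg]; exact not_le.mp hlt) hAq)
  have hdw : n ≤ dw + 1 := by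
    by_contra hlt
    exact hr0 (eq_zero_of_vecMul_mem_span hA.1 hdet0 hrdeg
      (by rw [hpdeg]; exact not_le.mp hlt) hrA)
  -- 4. top components of the extremal minimal representatives multiply outside the prime `(p)`
  haveI : Nonempty (Fin m) := ⟨i₁⟩
  obtain ⟨i₀, -, hi₀⟩ := Finset.exists_mem_eq_sup Finset.univ Finset.univ_nonempty
    fun i => (q i).totalDegree
  obtain ⟨j₀, -, hj₀⟩ := Finset.exists_mem_eq_sup Finset.univ Finset.univ_nonempty
    fun j => (r j).totalDegree
  have hqi₀ : q i₀ ≠ 0 := by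
    intro h
    have : (q i₀).totalDegree = 0 := by rw [h, totalDegree_zero]
    omega
  have hrj₀ : r j₀ ≠ 0 := by
    intro h
    have : (r j₀).totalDegree = 0 := by rw [h, totalDegree_zero]
    omega
  have htopq : homogeneousComponent dc (q i₀) ∉ I := by
    rw [hdc_def, hi₀]
    exact top_notMem_of_minimal hprime (hq i₀).2 hqi₀
  have htopr : homogeneousComponent dw (r j₀) ∉ I := by
    rw [hdw_def, hj₀]
    exact top_notMem_of_minimal hprime (hr j₀).2 hrj₀
  refine ⟨i₀, j₀, dc + dw, by omega, fun hmem => ?_⟩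
  have h1 := homogeneousComponent_mem_span hhom (hBqr i₀ j₀) (dc + dw)
  rw [map_sub, homogeneousComponent_mul_of_totalDegree_le _ _ (hqdeg i₀) (hrdeg j₀)] at h1
  have h2 : homogeneousComponent dc (q i₀) * homogeneousComponent dw (r j₀) ∈ I := by
    have := I.sub_mem hmem h1
    rwa [sub_sub_cancel] at this
  exact (hIprime.mem_or_mem h2).elim htopq htopr

/-- **Support item `UlrichPadded.CofactorDegreeFloor` (stmt-ValiantsHypothesis-5669), proved:**
for `n ≥ 3` and every affine determinantal representation `A` of `per_n` over `ℂ`, some cofactor of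
`A` has a homogeneous component of degree `≥ 2n − 2` not divisible by `per_n` — the budget
inequality `j ≤ m + 1 − 2n` in cofactor form (in particular `m − 1 ≥ 2n − 2`, i.e. the route's floor
`dc(per_n) ≥ 2n − 1`).  Corollary of the closed crux `RankOneTrivialisation` and the kernel-degree
floor `deg c, deg w ≥ n − 1`. [folklore] -/
theorem cofactorDegreeFloor_proof :
    Summit.ValiantsHypothesis.ValiantsHypothesis.Theses.UlrichPadded.CofactorDegreeFloor :=
  fun n hn m A hA => cofactorDegreeFloor_of_rankOne n hn m A hA

end Summit.ValiantsHypothesis.Theorems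

end
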